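import Literature.Probability.Distributions.GaussianWickTheorem

/-!
# Second moment of a trace-free cubic form of a centred Gaussian process («third-chaos contraction»)
# — E(2) of planner ym-idea-2 g15's STUB-PLAN-E for stub E `stub_tiltMoments` of LINE-17 (crux `BoxMidWindowsSU22`, stmt-QuantumFields-24003)

For a centred Gaussian process `X : T → Ω → ℝ` (Mathlib `IsGaussianProcess`, `E X_t = 0`), finitely many legs `t : κ → T` with two-point
function `C a b = E[X_{t a} X_{t b}]`, and a 3-tensor `B : κ → κ → κ → ℝ` whose three partial `C`-traces vanish
(`Σ_{ab} B_{abc} C_{ab} = 0`, `Σ_{ac} B_{abc} C_{ac} = 0`, `Σ_{bc} B_{abc} C_{bc} = 0` — i.e. `Σ B X X X` is a Wick polynomial of degree 3):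

* `integral_prod_six` — the six-point Wick/Isserlis formula, as the first-leg recursion `E[X₀X₁⋯X₅] = Σ_{m=1}^{5} E[X₀X_m]·E[∏_{l≠0,m} X_l]`
  (15 pairings after the tree's four-point formula `GaussianWick.integral_prod_four`; from the tree's Gaussian integration by parts
  `GaussianWick.integral_mul_prod_eq_sum`, exactly as the tree proves the four-point case);
* `integral_cubicForm_sq` — **`E[(Σ_{abc} B_{abc} X_a X_b X_c)²] = Σ_{abc a'b'c'} B_{abc} B_{a'b'c'} Σ_{σ ∈ S₃} C_{aσ(a)'} C_{bσ(b)'} C_{cσ(c)'}`**: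
  of the 15 pairings of the six legs, the 9 containing a pair inside a triple die by the trace conditions (`sum6_pair12/13/23_eq_zero`),
  the 6 bipartite ones survive (cf. S. Janson, *Gaussian Hilbert Spaces*, Thm 1.28 and Thm 3.9: Wick products of different chaoses are
  orthogonal and `E[:ξ₁ξ₂ξ₃::η₁η₂η₃:] = Σ_σ Π E[ξ_iη_{σ(i)}]`).
The planner's use (STUB-PLAN-E §2 E(2)–E(3)): legs = (free edge, colour), `C = Q_D⁻¹ ⊗ δ`, `B = A ⊗ ε` — the variance of the cubic tilt `V₃`.
Pure Mathlib + the tree's `GaussianWickTheorem`; no definition.  HONEST LABEL: probabilistic helper for an open registered stub of a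
critic-passed line on the R2ξ″ RECORD-rung crux 24003; no stub is proved by name, no crux, rung or summit is proved; the Yang–Mills
mass gap is NOT proved by this.
-/

set_option autoImplicit false

noncomputable section

open MeasureTheory ProbabilityTheory Finset
open Literature.Probability.Distributions.GaussianWick

namespace Summit.QuantumFields.YangMills.Theorems.AllWindowsColdBox.CubicChaos

variable {T Ω : Type*} {mΩ : MeasurableSpace Ω} {P : Measure Ω} {X : T → Ω → ℝ}

/-! ## Six legs: integrability and the six-point formula -/

/-- A product of six coordinates of a Gaussian process is integrable. -/
theorem integrable_mul_six (hX : IsGaussianProcess X P) (x₀ x₁ x₂ x₃ x₄ x₅ : T) :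
    Integrable (fun ω => X x₀ ω * X x₁ ω * X x₂ ω * X x₃ ω * X x₄ ω * X x₅ ω) P := by
  have h := integrable_prod hX (Finset.univ : Finset (Fin 6)) ![x₀, x₁, x₂, x₃, x₄, x₅]
  refine h.congr (ae_of_all _ fun ω => ?_)
  simp only [Fin.prod_univ_six]
  rfl

/-- The four-point formula of the tree with explicit legs. -/
theorem integral_mul_four (hX : IsGaussianProcess X P) (h0 : ∀ t, ∫ ω, X t ω ∂P = 0) (p q r s : T) :
    ∫ ω, X p ω * X q ω * X r ω * X s ω ∂P =
      (∫ ω, X p ω * X q ω ∂P) * (∫ ω, X r ω * X s ω ∂P) +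
      (∫ ω, X p ω * X r ω ∂P) * (∫ ω, X q ω * X s ω ∂P) +
      (∫ ω, X p ω * X s ω ∂P) * (∫ ω, X q ω * X r ω ∂P) :=
  integral_prod_four hX h0 ![p, q, r, s]

/-- **Six-point Wick formula, first-leg recursion**: `E[X₀X₁X₂X₃X₄X₅] = Σ_{m=1}^{5} E[X₀X_m] · E[∏_{l ≠ 0, m} X_l]` (each four-point factor is
then three pairings by `integral_mul_four`: 15 pairings in all). -/
theorem integral_prod_six (hX : IsGaussianProcess X P) (h0 : ∀ t, ∫ ω, X t ω ∂P = 0) (x₀ x₁ x₂ x₃ x₄ x₅ : T) :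
    ∫ ω, X x₀ ω * X x₁ ω * X x₂ ω * X x₃ ω * X x₄ ω * X x₅ ω ∂P =
      (∫ ω, X x₀ ω * X x₁ ω ∂P) * (∫ ω, X x₂ ω * X x₃ ω * X x₄ ω * X x₅ ω ∂P) +
      (∫ ω, X x₀ ω * X x₂ ω ∂P) * (∫ ω, X x₁ ω * X x₃ ω * X x₄ ω * X x₅ ω ∂P) +
      (∫ ω, X x₀ ω * X x₃ ω ∂P) * (∫ ω, X x₁ ω * X x₂ ω * X x₄ ω * X x₅ ω ∂P) +
      (∫ ω, X x₀ ω * X x₄ ω ∂P) * (∫ ω, X x₁ ω * X x₂ ω * X x₃ ω * X x₅ ω ∂P) +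
      (∫ ω, X x₀ ω * X x₅ ω ∂P) * (∫ ω, X x₁ ω * X x₂ ω * X x₃ ω * X x₄ ω ∂P) := by
  classical
  set y : Fin 5 → T := ![x₁, x₂, x₃, x₄, x₅] with hy
  have hy0 : y 0 = x₁ := rfl
  have hy1 : y 1 = x₂ := rfl
  have hy2 : y 2 = x₃ := rfl
  have hy3 : y 3 = x₄ := rfl
  have hy4 : y 4 = x₅ := rfl
  have h := integral_mul_prod_eq_sum hX h0 x₀ (Finset.univ : Finset (Fin 5)) y
  have hl : ∀ ω, X x₀ ω * X x₁ ω * X x₂ ω * X x₃ ω * X x₄ ω * X x₅ ω = X x₀ ω * ∏ j : Fin 5, X (y j) ω := fun ω => by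
    rw [Fin.prod_univ_five, hy0, hy1, hy2, hy3, hy4]
    ring
  simp_rw [hl]
  rw [h, Fin.sum_univ_five]
  have e0 : ∀ f : Fin 5 → ℝ, ∏ i ∈ (Finset.univ : Finset (Fin 5)).erase 0, f i = f 1 * f 2 * f 3 * f 4 := fun f => by
    rw [show (Finset.univ : Finset (Fin 5)).erase 0 = {1, 2, 3, 4} by decide,
      Finset.prod_insert (by decide), Finset.prod_insert (by decide), Finset.prod_pair (by decide)]
    ring
  have e1 : ∀ f : Fin 5 → ℝ, ∏ i ∈ (Finset.univ : Finset (Fin 5)).erase 1, f i = f 0 * f 2 * f 3 * f 4 := fun f => by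
    rw [show (Finset.univ : Finset (Fin 5)).erase 1 = {0, 2, 3, 4} by decide,
      Finset.prod_insert (by decide), Finset.prod_insert (by decide), Finset.prod_pair (by decide)]
    ring
  have e2 : ∀ f : Fin 5 → ℝ, ∏ i ∈ (Finset.univ : Finset (Fin 5)).erase 2, f i = f 0 * f 1 * f 3 * f 4 := fun f => by
    rw [show (Finset.univ : Finset (Fin 5)).erase 2 = {0, 1, 3, 4} by decide,
      Finset.prod_insert (by decide), Finset.prod_insert (by decide), Finset.prod_pair (by decide)]
    ring
  have e3 : ∀ f : Fin 5 → ℝ, ∏ i ∈ (Finset.univ : Finset (Fin 5)).erase 3, f i = f 0 * f 1 * f 2 * f 4 := fun f => by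
    rw [show (Finset.univ : Finset (Fin 5)).erase 3 = {0, 1, 2, 4} by decide,
      Finset.prod_insert (by decide), Finset.prod_insert (by decide), Finset.prod_pair (by decide)]
    ring
  have e4 : ∀ f : Fin 5 → ℝ, ∏ i ∈ (Finset.univ : Finset (Fin 5)).erase 4, f i = f 0 * f 1 * f 2 * f 3 := fun f => by
    rw [show (Finset.univ : Finset (Fin 5)).erase 4 = {0, 1, 2, 3} by decide,
      Finset.prod_insert (by decide), Finset.prod_insert (by decide), Finset.prod_pair (by decide)]
    ring
  simp only [e0, e1, e2, e3, e4, hy0, hy1, hy2, hy3, hy4]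

/-! ## Six-fold sums: bookkeeping -/

section Sums

variable {κ : Type*} [Fintype κ]

/-- Pointwise rewriting under a six-fold sum. -/
theorem sum6_congr {f g : κ → κ → κ → κ → κ → κ → ℝ} (h : ∀ a b c a' b' c', f a b c a' b' c' = g a b c a' b' c') :
    (∑ a, ∑ b, ∑ c, ∑ a', ∑ b', ∑ c', f a b c a' b' c') = ∑ a, ∑ b, ∑ c, ∑ a', ∑ b', ∑ c', g a b c a' b' c' := by
  simp only [h]

/-- A six-fold sum as one sum over `κ⁶`. -/
theorem sum6_eq_sum_prod (f : κ → κ → κ → κ → κ → κ → ℝ) :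
    (∑ a, ∑ b, ∑ c, ∑ a', ∑ b', ∑ c', f a b c a' b' c') =
      ∑ z : κ × κ × κ × κ × κ × κ, f z.1 z.2.1 z.2.2.1 z.2.2.2.1 z.2.2.2.2.1 z.2.2.2.2.2 := by
  simp only [Fintype.sum_prod_type]

/-- `Σ_a Σ_b Σ_c f = Σ_c Σ_a Σ_b f`. -/
theorem sum3_rotate (f : κ → κ → κ → ℝ) : (∑ a, ∑ b, ∑ c, f a b c) = ∑ c, ∑ a, ∑ b, f a b c := by
  calc (∑ a, ∑ b, ∑ c, f a b c) = ∑ a, ∑ c, ∑ b, f a b c := Finset.sum_congr rfl fun a _ => Finset.sum_comm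
    _ = ∑ c, ∑ a, ∑ b, f a b c := Finset.sum_comm

/-- The inner triple sum factors out of a product term. -/
theorem sum3_inner_factor (B : κ → κ → κ → ℝ) (u : κ → κ → κ → ℝ) (F : κ → κ → κ → κ → κ → κ → ℝ) (a b c : κ) :
    (∑ a', ∑ b', ∑ c', B a b c * B a' b' c' * (u a b c * F a b c a' b' c')) =
      (B a b c * u a b c) * ∑ a', ∑ b', ∑ c', B a' b' c' * F a b c a' b' c' := by
  simp only [Finset.mul_sum]
  exact Finset.sum_congr rfl fun _ _ => Finset.sum_congr rfl fun _ _ => Finset.sum_congr rfl fun _ _ => by ring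

/-- A pairing inside the first triple, legs `(b, c)`: killed by the trace condition `Σ_{bc} B_{abc} C_{bc} = 0`. -/
theorem sum6_pair23_eq_zero (B : κ → κ → κ → ℝ) (C : κ → κ → ℝ) (hB23 : ∀ a, (∑ b, ∑ c, B a b c * C b c) = 0)
    (F : κ → κ → κ → κ → ℝ) :
    (∑ a, ∑ b, ∑ c, ∑ a', ∑ b', ∑ c', B a b c * B a' b' c' * (C b c * F a a' b' c')) = 0 := by
  have h1 : ∀ a b c, (∑ a', ∑ b', ∑ c', B a b c * B a' b' c' * (C b c * F a a' b' c')) =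
      (B a b c * C b c) * ∑ a', ∑ b', ∑ c', B a' b' c' * F a a' b' c' := fun a b c =>
    sum3_inner_factor B (fun _ b c => C b c) (fun a _ _ a' b' c' => F a a' b' c') a b c
  simp_rw [h1]
  refine Finset.sum_eq_zero fun a _ => ?_
  rw [show (∑ b, ∑ c, B a b c * C b c * ∑ a', ∑ b', ∑ c', B a' b' c' * F a a' b' c') =
      (∑ b, ∑ c, B a b c * C b c) * ∑ a', ∑ b', ∑ c', B a' b' c' * F a a' b' c' by
    rw [Finset.sum_mul]; exact Finset.sum_congr rfl fun b _ => by rw [Finset.sum_mul]]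
  rw [hB23 a, zero_mul]

/-- A pairing inside the first triple, legs `(a, c)`: killed by `Σ_{ac} B_{abc} C_{ac} = 0`. -/
theorem sum6_pair13_eq_zero (B : κ → κ → κ → ℝ) (C : κ → κ → ℝ) (hB13 : ∀ b, (∑ a, ∑ c, B a b c * C a c) = 0)
    (F : κ → κ → κ → κ → ℝ) :
    (∑ a, ∑ b, ∑ c, ∑ a', ∑ b', ∑ c', B a b c * B a' b' c' * (C a c * F b a' b' c')) = 0 := by
  have h1 : ∀ a b c, (∑ a', ∑ b', ∑ c', B a b c * B a' b' c' * (C a c * F b a' b' c')) =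
      (B a b c * C a c) * ∑ a', ∑ b', ∑ c', B a' b' c' * F b a' b' c' := fun a b c =>
    sum3_inner_factor B (fun a _ c => C a c) (fun _ b _ a' b' c' => F b a' b' c') a b c
  simp_rw [h1]
  rw [Finset.sum_comm]
  refine Finset.sum_eq_zero fun b _ => ?_
  rw [show (∑ a, ∑ c, B a b c * C a c * ∑ a', ∑ b', ∑ c', B a' b' c' * F b a' b' c') =
      (∑ a, ∑ c, B a b c * C a c) * ∑ a', ∑ b', ∑ c', B a' b' c' * F b a' b' c' by
    rw [Finset.sum_mul]; exact Finset.sum_congr rfl fun a _ => by rw [Finset.sum_mul]]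
  rw [hB13 b, zero_mul]

/-- A pairing inside the first triple, legs `(a, b)`: killed by `Σ_{ab} B_{abc} C_{ab} = 0`. -/
theorem sum6_pair12_eq_zero (B : κ → κ → κ → ℝ) (C : κ → κ → ℝ) (hB12 : ∀ c, (∑ a, ∑ b, B a b c * C a b) = 0)
    (F : κ → κ → κ → κ → ℝ) :
    (∑ a, ∑ b, ∑ c, ∑ a', ∑ b', ∑ c', B a b c * B a' b' c' * (C a b * F c a' b' c')) = 0 := by
  have h1 : ∀ a b c, (∑ a', ∑ b', ∑ c', B a b c * B a' b' c' * (C a b * F c a' b' c')) =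
      (B a b c * C a b) * ∑ a', ∑ b', ∑ c', B a' b' c' * F c a' b' c' := fun a b c =>
    sum3_inner_factor B (fun a b _ => C a b) (fun _ _ c a' b' c' => F c a' b' c') a b c
  simp_rw [h1]
  rw [sum3_rotate]
  refine Finset.sum_eq_zero fun c _ => ?_
  rw [show (∑ a, ∑ b, B a b c * C a b * ∑ a', ∑ b', ∑ c', B a' b' c' * F c a' b' c') =
      (∑ a, ∑ b, B a b c * C a b) * ∑ a', ∑ b', ∑ c', B a' b' c' * F c a' b' c' by
    rw [Finset.sum_mul]; exact Finset.sum_congr rfl fun a _ => by rw [Finset.sum_mul]]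
  rw [hB12 c, zero_mul]

end Sums

/-! ## The second moment of a trace-free cubic form -/

/-- **Third-chaos contraction.**  For a centred Gaussian process and a 3-tensor `B` on finitely many legs whose three partial traces against
the two-point function `C` vanish, `E[(Σ_{abc} B_{abc} X_a X_b X_c)²]` is the sum over the SIX bipartite pairings only:
`Σ_{abc a'b'c'} B_{abc} B_{a'b'c'} (C_{aa'}(C_{bb'}C_{cc'} + C_{bc'}C_{cb'}) + C_{ab'}(C_{ba'}C_{cc'} + C_{bc'}C_{ca'}) + C_{ac'}(C_{ba'}C_{cb'} + C_{bb'}C_{ca'}))`. -/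
theorem integral_cubicForm_sq (hX : IsGaussianProcess X P) (h0 : ∀ s, ∫ ω, X s ω ∂P = 0)
    {κ : Type*} [Fintype κ] (t : κ → T) (C : κ → κ → ℝ) (hC : ∀ a b, C a b = ∫ ω, X (t a) ω * X (t b) ω ∂P)
    (B : κ → κ → κ → ℝ) (hB12 : ∀ c, (∑ a, ∑ b, B a b c * C a b) = 0) (hB13 : ∀ b, (∑ a, ∑ c, B a b c * C a c) = 0)
    (hB23 : ∀ a, (∑ b, ∑ c, B a b c * C b c) = 0) :
    ∫ ω, (∑ a, ∑ b, ∑ c, B a b c * (X (t a) ω * X (t b) ω * X (t c) ω)) ^ 2 ∂P =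
      ∑ a, ∑ b, ∑ c, ∑ a', ∑ b', ∑ c', B a b c * B a' b' c' *
        (C a a' * (C b b' * C c c' + C b c' * C c b') + C a b' * (C b a' * C c c' + C b c' * C c a') +
          C a c' * (C b a' * C c b' + C b b' * C c a')) := by
  classical
  -- Step A: the square as a six-fold sum, pointwise
  have hsq : ∀ ω, (∑ a, ∑ b, ∑ c, B a b c * (X (t a) ω * X (t b) ω * X (t c) ω)) ^ 2 =
      ∑ a, ∑ b, ∑ c, ∑ a', ∑ b', ∑ c', B a b c * B a' b' c' *
        (X (t a) ω * X (t b) ω * X (t c) ω * X (t a') ω * X (t b') ω * X (t c') ω) := by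
    intro ω
    rw [sq, Finset.sum_mul]
    simp only [Finset.sum_mul]
    simp only [Finset.mul_sum]
    exact sum6_congr fun _ _ _ _ _ _ => by ring
  simp_rw [hsq]
  -- Step B: exchange integral and sums
  have hint : ∀ a b c a' b' c', Integrable (fun ω => B a b c * B a' b' c' *
      (X (t a) ω * X (t b) ω * X (t c) ω * X (t a') ω * X (t b') ω * X (t c') ω)) P := fun a b c a' b' c' =>
    (integrable_mul_six hX _ _ _ _ _ _).const_mul _
  have hswap : ∫ ω, ∑ a, ∑ b, ∑ c, ∑ a', ∑ b', ∑ c', B a b c * B a' b' c' *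
        (X (t a) ω * X (t b) ω * X (t c) ω * X (t a') ω * X (t b') ω * X (t c') ω) ∂P =
      ∑ a, ∑ b, ∑ c, ∑ a', ∑ b', ∑ c', ∫ ω, B a b c * B a' b' c' *
        (X (t a) ω * X (t b) ω * X (t c) ω * X (t a') ω * X (t b') ω * X (t c') ω) ∂P := by
    simp_rw [sum6_eq_sum_prod]
    rw [integral_finsetSum _ fun z _ => hint _ _ _ _ _ _]
  rw [hswap]
  -- Step C/D: each term is `B B' ×` the six-point function, i.e. the 15 pairings
  have h6 : ∀ a b c a' b' c', ∫ ω, B a b c * B a' b' c' *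
        (X (t a) ω * X (t b) ω * X (t c) ω * X (t a') ω * X (t b') ω * X (t c') ω) ∂P =
      B a b c * B a' b' c' *
        (C a a' * (C b b' * C c c' + C b c' * C c b') + C a b' * (C b a' * C c c' + C b c' * C c a') +
            C a c' * (C b a' * C c b' + C b b' * C c a') +
          C a b * (C c a' * C b' c' + C c b' * C a' c' + C c c' * C a' b') +
          C a c * (C b a' * C b' c' + C b b' * C a' c' + C b c' * C a' b') +
          C b c * (C a a' * C b' c' + C a b' * C a' c' + C a c' * C a' b')) := by
    intro a b c a' b' c'
    rw [integral_const_mul, integral_prod_six hX h0, integral_mul_four hX h0, integral_mul_four hX h0,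
      integral_mul_four hX h0, integral_mul_four hX h0, integral_mul_four hX h0]
    simp only [← hC]
    ring
  rw [sum6_congr h6]
  -- Step E: split off the nine intra-triple pairings and kill them
  have hsplit : ∀ a b c a' b' c', B a b c * B a' b' c' *
        (C a a' * (C b b' * C c c' + C b c' * C c b') + C a b' * (C b a' * C c c' + C b c' * C c a') +
            C a c' * (C b a' * C c b' + C b b' * C c a') +
          C a b * (C c a' * C b' c' + C c b' * C a' c' + C c c' * C a' b') +
          C a c * (C b a' * C b' c' + C b b' * C a' c' + C b c' * C a' b') +
          C b c * (C a a' * C b' c' + C a b' * C a' c' + C a c' * C a' b')) =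
      B a b c * B a' b' c' *
          (C a a' * (C b b' * C c c' + C b c' * C c b') + C a b' * (C b a' * C c c' + C b c' * C c a') +
            C a c' * (C b a' * C c b' + C b b' * C c a')) +
        B a b c * B a' b' c' * (C a b * (C c a' * C b' c' + C c b' * C a' c' + C c c' * C a' b')) +
        B a b c * B a' b' c' * (C a c * (C b a' * C b' c' + C b b' * C a' c' + C b c' * C a' b')) +
        B a b c * B a' b' c' * (C b c * (C a a' * C b' c' + C a b' * C a' c' + C a c' * C a' b')) := by
    intro a b c a' b' c'; ring
  rw [sum6_congr hsplit]
  simp only [Finset.sum_add_distrib]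
  rw [sum6_pair12_eq_zero B C hB12 (fun c a' b' c' => C c a' * C b' c' + C c b' * C a' c' + C c c' * C a' b'),
    sum6_pair13_eq_zero B C hB13 (fun b a' b' c' => C b a' * C b' c' + C b b' * C a' c' + C b c' * C a' b'),
    sum6_pair23_eq_zero B C hB23 (fun a a' b' c' => C a a' * C b' c' + C a b' * C a' c' + C a c' * C a' b')]
  ring

end Summit.QuantumFields.YangMills.Theorems.AllWindowsColdBox.CubicChaos

end
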